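import Summits.BirchSwinnertonDyer.BirchSwinnertonDyer.Theorems.BiquadraticEisensteinDescentManinDatumSupercuspidalCMInertModelLValuesOfTorsionIntegral
import Summits.BirchSwinnertonDyer.BirchSwinnertonDyer.Theorems.BiquadraticEisensteinDescentManinDatumSupercuspidalCMInertPointwiseLever
import Summits.BirchSwinnertonDyer.BirchSwinnertonDyer.Theorems.InertBadSignedBranchesInertBadAtThreeQuarticValueExit
import Summits.BirchSwinnertonDyer.BirchSwinnertonDyer.Theorems.InertBadSignedBranchesInertBadAtThreeQuarticModelUnit
import HarnessLib

set_option linter.dupNamespace false -- `Summit.BirchSwinnertonDyer.BirchSwinnertonDyer.Theorems.…` (summit = sub, D-0017)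
set_option autoImplicit false

/-!
# Crux `ManinDatumSupercuspidalCMInert` (stmt-BirchSwinnertonDyer-20111, BED r605): the registered stub `stub_S7` (CM `j = 1728`, additive
# CM-inert `7`) from ONE statement about Eisenstein–Kronecker numbers of the Gaussian lattice — the `7`-integrality T₇ of the
# `(·/7)₄^k`-weighted `7`-TORSION SUMS of `E₁*` (width seat `bsd-wall-cm-bed-w2` g10; theorems only; route-independent imports;
# `--supports 20111`, helper)

Route `BiquadraticEisensteinDescent` (cell `pub/bsd-wall`, D-0152 M1). END-TO-END composition of the 2026-08-28 width wave on crux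
R₅₇-supercuspidal (`j = 1728` cell), all tree theorems, NO named fact:
  registered `stub_S7` ⟸ (bed-w4 g10, pointwise tame-twist lever p634645 `not_dvd_c_of_oddPrimeInstances57`) plain `7`-integrality of the
  odd twisted symbol sums of `W` ⟸ (this seat: fourth-power-free quartic model with `v₇(u_C) = 0` p634958, transport `LValueOdd_of_smul`,
  Birch) H₇ = `f`-free odd `L`-values of the models `E_A = y² = x³ + Ax`, `7 ∣ A` ⟸ (bed-w3 g9 inert theta dictionary p635899 + this seat's
  generic assembly p636292 + `…CMInertModelLValuesOfTorsionIntegral.H7_of_torsionIntegral` p636981) **T₇**: for `k ∈ {1, 2, 3}`, every `M′`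
  coprime to `7`, every integer `α` prime to `7` and every `w ∈ ℂ` with `M′w ∈ Λ = ℤi + ℤ`:
  `s · (Σ_{a mod 7} conj((a/7)₄)^k · E₁*(w + α·conj(a)/7)) / (ϖ₀ · 7^{(4−k)/4}) ∈ ℤ̄` for some `7 ∤ s`.

* `oddInstance_of_LValue'` — Birch: the lever's currency `s·Σ_aχ(a){∞,a/m}_f/(Ω⁻(W)·i) ∈ ℤ̄` from the `f`-free odd `L`-value statement
  (same as `…CMInertStubsOfModelLValues.oddInstance_of_LValue`, restated here to keep this file outside the route file's import cone).
* ★ `stub_S7_of_torsionIntegral` — the REGISTERED SIGNATURE of `stub_S7` VERBATIM from T₇.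

HONEST FRAMING: T₇ is NOT proved (its structural proof is a tame resolvent count in `ℚ₄₉(E[7])`, see the docstring of
`…CMInertModelLValuesOfTorsionIntegral`); nothing here proves the stub, the crux, Manin's conjecture or BSD. No definition, no named fact, no
`sorry`; axioms standard.
-/

noncomputable section

open scoped Classical ComplexConjugate MatrixGroups

open Complex PeriodPair WeierstrassCurve IsDedekindDomain NumberField
open Literature.NumberTheory.EllipticCurves Literature.NumberTheory.EllipticCurves.GaussianLattice
open Literature.NumberTheory.LFunctions Literature.NumberTheory.LFunctions.GaussianTheta
open Literature.NumberTheory.QuadraticFields.GaussianQuarticSymbol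
open Literature.NumberTheory.EllipticCurves.ModularForms
open Literature.NumberTheory.EllipticCurves.Rank1Residual
open Literature.NumberTheory.DiophantineGeometry

namespace Summit.BirchSwinnertonDyer.BirchSwinnertonDyer.Theorems.BiquadraticEisensteinDescentManinDatumSupercuspidalCMInertStubS7OfTorsionIntegral

open Summit.BirchSwinnertonDyer.BirchSwinnertonDyer.Theorems.ManinLocalTwoThree (isPrimitive_of_odd)
open Summit.BirchSwinnertonDyer.BirchSwinnertonDyer.Theorems.InertBadSignedBranchesInertBadAtThreeQuarticValueExit
  (twistedLSeries_eq_of_isNewformOf)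
open Summit.BirchSwinnertonDyer.BirchSwinnertonDyer.Theorems.InertBadSignedBranchesInertBadAtThreeQuarticModel (LValueOdd_of_smul)
open Summit.BirchSwinnertonDyer.BirchSwinnertonDyer.Theorems.InertBadSignedBranchesInertBadAtThreeQuarticModelUnit
  (not_dvd_quartic_of_not_dvd_conductorNorm)
open Summit.BirchSwinnertonDyer.BirchSwinnertonDyer.Theorems.BiquadraticEisensteinDescentManinDatumSupercuspidalCMInertCMModelsQuartic
  (exists_smul_eq_quartic_fourthPowerFree_of_ne_two)
open Summit.BirchSwinnertonDyer.BirchSwinnertonDyer.Theorems.BiquadraticEisensteinDescentManinDatumSupercuspidalCMInertPointwiseLever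
  (not_dvd_c_of_oddPrimeInstances57)
open Summit.BirchSwinnertonDyer.BirchSwinnertonDyer.Theorems.BiquadraticEisensteinDescentManinDatumSupercuspidalCMInertModelLValuesOfTorsionIntegral
  (H7_of_torsionIntegral)

/-- **Birch: the pointwise lever's currency from the `f`-free odd `L`-value** (`f` the newform of `W` at any level, `χ` primitive mod `m`):
`s·τ(χ)·L(1)/(i·Ω⁻(W)) ∈ ℤ̄` for some entire continuation `L` of `Σ χ̄(n)a_n(W)n⁻ˢ` gives `s·Σ_aχ(a){∞,a/m}_f/(Ω⁻(W)·i) ∈ ℤ̄`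
(`ModularForms.twisted_LValue_eq_holds`, `a_n(f) = a_n(W)`). [cite: MazurTateTeitelbaum1986, §I.8 (8.6)] -/
theorem oddInstance_of_LValue' {N : ℕ} [NeZero N] {m : ℕ} [NeZero m] {p : ℕ} (W : WeierstrassCurve ℚ)
    {f : CuspForm (CongruenceSubgroup.Gamma0 N) 2} (hf : IsNewformOf W f) {χ : DirichletCharacter ℂ m} (hχ : χ.IsPrimitive)
    (hint : ∃ L : ℂ → ℂ, Differentiable ℂ L ∧
      (∀ s : ℂ, 2 < s.re → L s = LSeries (fun n : ℕ ↦ χ⁻¹ (n : ZMod m) * (W.LFunction n : ℂ)) s) ∧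
      ∃ s : ℕ, ¬ p ∣ s ∧ IsIntegral ℤ ((s : ℂ) *
        (gaussSum χ (ZMod.stdAddChar (N := m)) * L 1 / (Complex.I * (W.imaginaryPeriodRat : ℂ))))) :
    ∃ s : ℕ, ¬ p ∣ s ∧ IsIntegral ℤ ((s : ℂ) * (twistedSymbolSum f χ / ((W.imaginaryPeriodRat : ℂ) * Complex.I))) := by
  obtain ⟨L, hLd, hLs, s, hps, hsint⟩ := hint
  refine ⟨s, hps, ?_⟩
  have hLs' : ∀ z : ℂ, 2 < z.re → L z = twistedLSeries f χ⁻¹ z := fun z hz ↦ by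
    rw [hLs z hz, twistedLSeries_eq_of_isNewformOf W hf]
  have hBirch : gaussSum χ (ZMod.stdAddChar (N := m)) * L 1 = twistedSymbolSum f χ := by
    have h := twisted_LValue_eq_holds f (m := m) (isPrimitive_inv hχ) hLd hLs'
    rwa [inv_inv] at h
  rw [← hBirch, mul_comm (W.imaginaryPeriodRat : ℂ) Complex.I]
  exact hsint

/-- ★ **Registered stub `stub_S7` of skeleton `9438078f…` (crux `ManinDatumSupercuspidalCMInert`, BED r605) — its signature VERBATIM — from the
torsion hypothesis T₇ alone.** For `W/ℚ` globally minimal CM of analytic rank one, `p = 7`, `j(W) = 1728`, `7` inert in the CM field and bad, `D` a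
lattice-optimal `X₀(N_W)`-datum, the place `v` over `7` of type III/III*: `7 ∤ c(D)` — GRANTED T₇. Chain: fourth-power-free quartic model
`C • W = E_A` with `7 ∣ A`, `v₇(u_C) = 0`; the lever's auxiliary primes `d′ > N_W` are `∤ N_W`, hence `∤ A`; H₇ at `(A, d′, χ)` from T₇
(`H7_of_torsionIntegral`); transport `LValueOdd_of_smul`; Birch; bed-w4 g10's `not_dvd_c_of_oddPrimeInstances57`. Rank, CM-inert and Kodaira
binders idle. [cite: Manin1972, Thm. 1.6] [cite: Rubin1999, Prop. 7.15] [cite: IrelandRosen1982, Ch. 18 §7] [cite: SilvermanAEC2009, X.5.4 (iii)] -/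
theorem stub_S7_of_torsionIntegral
    (hT : ∀ (k : ℕ), 1 ≤ k → k ≤ 3 → ∀ (M' : ℕ) [NeZero M'], Nat.Coprime 7 M' →
      ∀ (α : ℤ), ¬ (7 : ℤ) ∣ α → ∀ (w : ℂ), (M' : ℂ) * w ∈ (ofUpperHalfPlane UpperHalfPlane.I).lattice →
      ∃ s : ℕ, ¬ 7 ∣ s ∧ IsIntegral ℤ ((s : ℂ) *
        (∑ a : ZMod 7 × ZMod 7, (conj (((quarticCharMod 7 (rep 7 a 0) : GaussianInt) : ℂ))) ^ k *
            kroneckerE₁ (w + (α : ℂ) * conj ((rep 7 a 0 : GaussianInt) : ℂ) / 7)) /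
          ((((Real.Gamma (1 / 4) ^ 2 / (2 * Real.sqrt (2 * Real.pi))) : ℝ) : ℂ) * (7 : ℂ) ^ (((4 - k : ℕ) : ℂ) / 4)))) :
    ∀ (W : WeierstrassCurve ℚ) [W.IsElliptic] [W.IsGloballyMinimal] [NeZero (W.conductorNorm ℤ)] (p : ℕ)
      [Fact p.Prime] (D : ModularParametrizationData W (W.conductorNorm ℤ)) (v : IsDedekindDomain.HeightOneSpectrum ℤ),
      Rat.HeightOneSpectrum.natGenerator v = p → W.HasCM → W.analyticRank = 1 → p = 7 → W.j = 1728 →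
      CMInert W p → ¬ Good W p → (∀ z ∈ D.L.lattice, ∃ w ∈ periodLattice D.f, z = D.c * w) →
      (W.kodairaSymbolAt v = .III ∨ W.kodairaSymbolAt v = .IIIstar) → ¬ (p : ℤ) ∣ D.c := by
  intro W _ _ _ p _ D v _hv _hCM _hr hp7 hj _hin hbad hopt _hk
  subst hp7
  have hbad' : ¬ W.HasGoodReductionAtPrime 7 := hbad
  obtain ⟨A, C, hCV, hA0, h7A, h4, hu⟩ := exists_smul_eq_quartic_fourthPowerFree_of_ne_two (p := 7) (by norm_num) W hj hbad'
  have hpN : 7 ∣ W.conductorNorm ℤ := (W.dvd_conductorNorm_iff_not_hasGoodReductionAtPrime 7).mpr hbad'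
  have hN0 : 0 < W.conductorNorm ℤ := Nat.pos_of_ne_zero (NeZero.ne _)
  refine not_dvd_c_of_oddPrimeInstances57 (p := 7) (Or.inr rfl) W D hopt hpN ?_
  intro d' _ hd' hNd' h7d' hrd' h4d' hsq χ hχ
  haveI : Fact d'.Prime := ⟨hd'⟩
  have hd'N : ¬ d' ∣ W.conductorNorm ℤ := fun h ↦ absurd hNd' (not_lt.mpr (Nat.le_of_dvd hN0 h))
  have h7N : 7 ≤ W.conductorNorm ℤ := Nat.le_of_dvd hN0 hpN
  have hd'2 : d' ≠ 2 := by omega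
  have hd'A : ¬ (d' : ℤ) ∣ A := not_dvd_quartic_of_not_dvd_conductorNorm W hCV h4 hd' hd'2 hd'N
  have h3d' : ¬ 3 ∣ d' - 1 := hrd' 3 Nat.prime_three (by norm_num) (by norm_num)
  have hsq' : IsSquare ((7 : ℕ) : ZMod d') := by
    rcases hsq with h | h
    · omega
    · exact h
  have hmodel := H7_of_torsionIntegral hT A hA0 h7A h4 d' hd' hd'2 hd'A h4d' h7d' h3d' hsq' χ hχ
  have hV := LValueOdd_of_smul (p := 7) W C (KramerTwoDescent.not_dvd_den_of_padicValRat_eq_zero hu) χ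
    (by rw [hCV]; exact hmodel)
  exact oddInstance_of_LValue' W D.isNewformOf (isPrimitive_of_odd hχ) hV

end Summit.BirchSwinnertonDyer.BirchSwinnertonDyer.Theorems.BiquadraticEisensteinDescentManinDatumSupercuspidalCMInertStubS7OfTorsionIntegral

end
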